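import Summits.QuantumFields.YangMills.Theorems.BalabanUVNodesKLCPrAtHierFrameInClass
import Summits.QuantumFields.YangMills.Theorems.BalabanUVNodesN21AveragedDatumRegularity
import HarnessLib

/-!
# K0ᴬ (KL-C) AT THE HIERARCHICAL GL FRAME — IN-CLASS GL PIN WITH PRINT'S (14) FOR THE AVERAGED BACKGROUNDS **DERIVED** FROM THE CLASS LETTER:
# `hreg : ∀ j < k, |Ū^j(U₀)(∂p) − 1| < α(L^jη_k)²` ⟸ `hcl : InUkClassB11 F N K k ε₀ U₀` + `2ε₀ ≤ α`, by [3] = [Balaban1985Averaging] Prop. 2 (52) ⇒ (53), k-UNIFORMLY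

Cell `ym-balaban-port` ∕ `pub-ymgap`, porter lineage `ymgap-nodeO-port-PTB-1` (g14), edition 13d of the K0ᴬ GL pin (13a = ✓`…KLCPrAtHierFrameInClass`, p835720).
`--kind proof --supports stmt-QuantumFields-27238 --as helper`; count-neutral.  [3] = [Balaban1985Averaging]; [B8] = [Balaban1985RegularSpaces]; [B9] = [Balaban1985BackgroundPropagators];
[B11] = [15] = [Balaban1985Variational]; [I] = [Balaban1987RG1].

WHY.  The in-class pins (13a §1–§3) display, next to the class letter `hcl : InUkClassB11 F N K k ε₀ U₀` ([B11] (2) at `Ω_j = T`: `|U₀(∂p) − 1| < ε₀η_k²(L^jη_k)^{−2}` at every window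
`j ≤ k` AND the covariant-divergence clause), print's (14)-type row for the AVERAGED backgrounds `hreg : ∀ j < k, PlaqSmall (α(L^jη_k)²) (Ū^j(U₀))` as an INDEPENDENT hypothesis.  It is
not independent: [B8] (1.128) p.98 ∕ [B11] p.278 («by Proposition 2 [4] the configuration V satisfies (7) with ε₁ = O(ε₀)») — [3] Prop. 2 (52) ⇒ (53): a fine configuration with
`|U(∂p) − 1| < α₀η_k²` has `|Ū^j(∂p′) − 1| < 2α₀(L^jη_k)²` at EVERY level `j ≤ k`, uniformly in `k`, once `C₀(d)α₀ ≤ ⅓` and `2α₀ ≤ 2δ_N∕((d+4)L)²` — PROVED in the tree for the averaging of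
record (lit ✓`BlockAveragingEMLProp2.plaqSmall_iter_blockAvg_eml_level`, any `SU(n)`; at the record ✓`N21AveragedDatumRegularity.plaqSmall_iter_avOfRecord_level`), and those two
smallness conditions at `α₀ := ε₀` ARE the pins' displayed ceilings `h3`, `h2`.

WHAT IS PROVED (sorry-free; no `def`; axioms standard).
* §0 `plaqSmall_iter_of_inUkClassB11` — `hcl`, `h3`, `h2`, `j ≤ k` ⟹ `PlaqSmall (2ε₀·(L^j·η_k)²) (Averaging.iter (avOfRecord F N K) j U₀)` (✓`InUkClassB11.mem_bgReg` +
  ✓`N21AveragedDatumRegularity.plaqSmall_iter_avOfRecord_level`; `0 < ε₀` from ✓`eps_pos_of_inUkClassB11`); `plaqSmall_iter_of_inUkClassB11_of_le` — the pins' `hreg` at any `α ≥ 2ε₀`.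
* §1 ★★★ `prop4UniformPrAtRecord_node00_of_prop5Clause_hierFrameGLRec_of_entryRows_inClassReg` = 13a §1 (generic `U₀`) with the binders `(hαpos : 0 < α)` and `hreg` REPLACED by
  `(hεα : 2 * ε₀ ≤ α)`; `hα : α·1.1e7·N ≤ 1` and the (157) threshold `α` of {W4} stay as they were; CONCLUSION byte-identical to 13a §1's (`Prop4UniformPrAtRecord … r Gp E R′`).
* §2 `…_inClassReg_ukSel` (U₀ := `UkSel F N K k ε V`, Thm 1 rows `hex huniq hcl` displayed), §3 `…_inClassReg_rootGaugeC_ukSel` (U₀ := `rootGaugeC k (UkSel …)`) — the 13a §2∕§3 twins.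
DISPLAY after this file: {W1} `hpos` · {W2} `h0∕h1` · {W3} `hS∕hR` · {W4} `h157` + `r + r ≤ α₁` · k-free window `hq` · `hα`, `2ε₀ ≤ α` · `hΩ` · `hcl` (+ `hex∕huniq` at the minimiser) ·
four ε₀ ceilings · numerics.  (14) for `Ū^j(U₀)` is DERIVED.  (The same three lines discharge `hreg` in the of-parts pins ✓`…KLCPrAtHierFrameOfParts`; not repeated here.)

HONEST FRAMING.  Glue BY NAME plus one kernel-checked print step ([3] Prop. 2, already in the tree); NO estimate of [B7]∕[B9]∕[B11] is proved here; {W1} (generic `U₀`), {W2}, {W3}, {W4}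
and [B11] Thm 1's rows are DISPLAYED hypotheses INHABITED NOWHERE; [B9] (3.35)–(3.36) for `U₀` (the hypothesis of Thm 3.12 behind {W2}) is NOT supplied by this file — its print
supplier from `hcl` is [B8] Prop. 6 ∕ [B11] Thm 1 (9)–(10), language-only in the tree (`B11Reg910Classes.Reg910T`; PT-B memo `W2-REG335-LOCATING-MEMO-g14.md`); K0ᴬ
⟨stmt-QuantumFields-27238⟩ NOT closed; ⟨27931⟩ CLOSED·IMPLICATION-ONLY; NODE O 0∕1; COUNT 8∕28 · K 1∕4 UNMOVED; one finite `𝕋⁴_{L^K}` programme at fixed ε — NOT continuum ∕ ℝ⁴ ∕ OS ∕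
Clay; **the Yang–Mills mass gap (Clay) is NOT proved by any of this.**  No `sorry`, `instance`, `notation`, `set_option`; standard axioms.
-/

noncomputable section

open scoped Matrix Matrix.Norms.L2Operator InnerProductSpace ComplexConjugate BigOperators
open Classical

namespace Summit.QuantumFields.YangMills.Theorems.KExpOfRecordPr

open Literature.MathematicalPhysics.QuantumFieldTheory.Balaban1983to89
open Literature.MathematicalPhysics.QuantumFieldTheory.Balaban1983to89.Node00
open Literature.MathematicalPhysics.QuantumFieldTheory.Balaban1983to89.B12GaugeOrbits021 (OrbitRel)
open Literature.MathematicalPhysics.QuantumFieldTheory.Balaban1983to89.BlockAveragingEMLHaarAC (emlWeight)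
open Literature.MathematicalPhysics.QuantumFieldTheory.Balaban1983to89.ExpMeanLog (deltaSU)
open Summit.QuantumFields.YangMills.Theorems.KExpOfRecord (KRecIdx kexpOfRecord)
open T4Continuum BlockAveraging
open B11Eq103H1Complex (SiteL2K)
open B9SectCLatticeCarrier (Bond)
open B11Eq115Space (NegSup NegSize JetSup levWeight levWeight_apply)
open B11Eq111FrakG (nabla115)
open Summit.QuantumFields.YangMills.BalabanUVNodes.N07Prop4LetterHOfThm312 (blkOfBond)
open Summit.QuantumFields.YangMills.BalabanUVNodes.N07KernelEntriesOfRecord (entry0 entry1 nColOp)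
open Summit.QuantumFields.YangMills.BalabanUVNodes.N07KLNOfLocalityRows (blockRow0 blockRow1)
open Summit.QuantumFields.YangMills.BalabanUVNodes.N07AtRecordTwoTier (eps_pos_of_inUkClassB11)
open Summit.QuantumFields.YangMills.Theorems.BlockAvgCorrector (stokesConst)
open Summit.QuantumFields.YangMills.Theorems.N07QCplxOpOntoGuarded (qCplxOp_surjective_of_inUkClassB11 QprOfRecord_surjective_hierFrameGL_of_inUkClassB11)
open Summit.QuantumFields.YangMills.Theorems.RootedGaugeCentred (rootGaugeC orbitRel_rootGaugeC)
open GaugeField (gaugeAct)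

variable (F : T4Family) (N : ℕ) [NeZero N]

/-! ## §0  [3] Prop. 2 along the class: `hcl ⟹ hreg` -/

section Reg

variable {F N} {K k : ℕ} {ε₀ : ℝ} {U₀ : GaugeField (F.P K) 0 (SU N)}

/-- ★ **PRINT'S (14) FOR THE AVERAGED BACKGROUNDS FROM THE CLASS LETTER**: `InUkClassB11 F N K k ε₀ U₀` (so `|U₀(∂p) − 1| < ε₀η_k²`, ✓`InUkClassB11.mem_bgReg`) with
`C₀(d)ε₀ ≤ ⅓` and `2ε₀ ≤ 2δ_N∕((d+4)L)²` ⟹ `|Ū^j(U₀)(∂p′) − 1| < 2ε₀·(L^jη_k)²` for every `j ≤ k` — [3] Prop. 2 (52) ⇒ (53), k-uniform, BY NAME: dag-n21-c ✓`N21AveragedDatumRegularity.plaqSmall_iter_avOfRecord_level` (the lit iterate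
✓`BlockAveragingEMLProp2.plaqSmall_iter_blockAvg_eml_level` read at the averaging of record) fed with the class unpack ✓`InUkClassB11.mem_bgReg` ∕ `mem_bgReg_iff`.
[cite: Balaban1985Averaging, Prop. 2 (52)–(53) p.26; Balaban1985Variational, (2) p.278, (14) p.280; Balaban1985RegularSpaces, (1.128) p.98] -/
theorem plaqSmall_iter_of_inUkClassB11
    (h3 : (143 * (((((F.P K).d + 4 : ℕ) : ℝ)) ^ 2 / 4) ^ 2) * ε₀ ≤ 1 / 3)
    (h2 : 2 * ε₀ ≤ 2 * deltaSU (Fin N) / ((((F.P K).d + 4) * (F.P K).L : ℕ) : ℝ) ^ 2)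
    (hcl : InUkClassB11 F N K k ε₀ U₀) {j : ℕ} (hj : j ≤ k) :
    PlaqSmall (2 * ε₀ * ((F.L : ℝ) ^ j * (F.P K).eta k) ^ 2) (Averaging.iter (avOfRecord F N K) j U₀) := by
  have h52 : PlaqSmall (ε₀ * (F.P K).eta k ^ 2) U₀ := (mem_bgReg_iff F N K k ε₀ U₀).1 hcl.mem_bgReg
  have h := Summit.QuantumFields.YangMills.Theorems.N21AveragedDatumRegularity.plaqSmall_iter_avOfRecord_level K k
    (eps_pos_of_inUkClassB11 hcl) h3 h2 h52 hj
  simpa only [T4Family.P_L] using h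

/-- The same in the pins' shape `∀ j < k, PlaqSmall (α·(L^jη_k)²) (Ū^j(U₀))` for ANY `α ≥ 2ε₀` (monotonicity of `PlaqSmall` in its radius).
[cite: Balaban1985Averaging, Prop. 2 (52)–(53) p.26; Balaban1985Variational, (14) p.280] -/
theorem plaqSmall_iter_of_inUkClassB11_of_le {α : ℝ}
    (h3 : (143 * (((((F.P K).d + 4 : ℕ) : ℝ)) ^ 2 / 4) ^ 2) * ε₀ ≤ 1 / 3)
    (h2 : 2 * ε₀ ≤ 2 * deltaSU (Fin N) / ((((F.P K).d + 4) * (F.P K).L : ℕ) : ℝ) ^ 2)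
    (hcl : InUkClassB11 F N K k ε₀ U₀) (hεα : 2 * ε₀ ≤ α) :
    ∀ j, j < k → PlaqSmall (α * ((F.L : ℝ) ^ j * (F.P K).eta k) ^ 2) (Averaging.iter (avOfRecord F N K) j U₀) :=
  fun _ hj p => (plaqSmall_iter_of_inUkClassB11 h3 h2 hcl hj.le p).trans_le (mul_le_mul_of_nonneg_right hεα (sq_nonneg _))

end Reg

/-! ## §1  The in-class GL pin with (14) derived (generic `U₀`) -/

section InClassReg

variable (K k : ℕ) (Ω : ℕ → Set (Site (F.P K) 0)) (U₀ : GaugeField (F.P K) 0 (SU N))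
variable [Fact (0 < (F.L : ℝ))] [Fact (0 < (F.P K).eta k)] [Fact (0 < c0Rec F K k)] [Fact (∀ c, 0 < wBRec F K k c)]

/-- ★★★ **THE GL PIN, IN-CLASS EDITION, (14) DERIVED** — 13a §1 ✓`…_of_entryRows_inClass` with its binders `hαpos : 0 < α` and `hreg : ∀ j < k, PlaqSmall (α(L^jη_k)²) (Ū^j(U₀))`
REPLACED by the one comparison `hεα : 2ε₀ ≤ α` (§0: `hcl` + the displayed ceilings `h3`, `h2` give (14) at `2ε₀`, hence at `α`; `0 < α` from `0 < ε₀`, ✓`eps_pos_of_inUkClassB11`).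
Everything else — `hpos` ({W1} framed half), {W2} `h0∕h1`, {W3} `hS∕hR`, {W4} `h157` at threshold `α` + `r + r ≤ α₁`, the k-free window `hq`, `hα`, `hΩ`, `hcl`, the four ε₀ ceilings —
displayed VERBATIM, and the conclusion `Prop4UniformPrAtRecord … r Gp E R′` is 13a §1's byte for byte.  Glue BY NAME; nothing of [B7]∕[B9]∕[B11] proved; {W1}–{W4} INHABITED NOWHERE.
[cite: Balaban1985Variational, Prop. 4 (97)–(98) pp.292–293, (2) p.278, (14) p.280, (44)–(46) p.285, (72)–(73) p.289, (86)–(89) p.291, (103) p.293; Balaban1985Averaging, Prop. 2 (52)–(53) p.26, Proposition 5 (157) p.42; Balaban1985BackgroundPropagators, Thm 3.12 (3.132)–(3.133) p.422; Balaban1987RG1, (1.2) p.260] -/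
theorem prop4UniformPrAtRecord_node00_of_prop5Clause_hierFrameGLRec_of_entryRows_inClassReg (levB : PBond (F.P K) k → ℕ) (a : ℝ)
    (hpos : ∀ x, x ≠ 0 → 0 < RCLike.re ⟪x, laplaceAOfRecord F N k U₀ (QprOfRecord F N k U₀ (hierFrameGLDatumOfRecord F N k U₀)) (QprimeOfRecord F N k U₀) a x⟫_ℂ)
    (Gp : SiteL2K ℂ (F.P K).d (fun _ => (F.P K).sitesPerDir 0) (c0Rec F K k) (WRec N) →ₗ[ℂ]
      SiteL2K ℂ (F.P K).d (fun _ => (F.P K).sitesPerDir 0) (c0Rec F K k) (WRec N))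
    {α ε₀ : ℝ} (hkpos : 0 < k) (hkm : k ≤ (F.P K).m + (F.P K).K) (hΩ : ∀ x, x ∈ Ω k) (hα : α * (11000000 * N) ≤ 1) (hεα : 2 * ε₀ ≤ α)
    -- {W1}'s un-framed onto row `hqon` AND the current letter `‖J(U₀)‖ ≤ nJ` BOTH from [B11] (2)'s class letter `hcl` (dag-n07-e ✓p835435 `qCplxOp_surjective_of_inUkClassB11`;
    -- ✓`norm_JOfRecordAtBg_le_of_inUkClassB11`, `nJ := ε₀`), at the price of MODULE 144's four ceilings on `ε₀` (`0 < ε₀` is forced by the class: ✓`eps_pos_of_inUkClassB11`)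
    (h3 : (143 * (((((F.P K).d + 4 : ℕ) : ℝ)) ^ 2 / 4) ^ 2) * ε₀ ≤ 1 / 3)
    (h2 : 2 * ε₀ ≤ 2 * deltaSU (Fin N) / ((((F.P K).d + 4) * (F.P K).L : ℕ) : ℝ) ^ 2)
    (hst : stokesConst (F.P K) * (2 * ε₀) < emlWeight (F.P K) / 16) (hstδ : stokesConst (F.P K) * (2 * ε₀) < deltaSU (Fin N))
    (hcl : InUkClassB11 F N K k ε₀ U₀)
    -- {W2} := the (3.133) entry rows of `H₁^{pr}(U₀)` at `(B₀, ρ)` ([B9] Thm 3.12; lane N07) — DISPLAYED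
    {B₀ ρ : ℝ} (hB₀ : 0 ≤ B₀) (hρ : 0 < ρ)
    (h0 : ∀ y'' y : PBond (F.P K) k, entry0 F N K k Ω U₀ levB (H1prOfRecordAtBg F N K k Ω U₀ (hierFrameGLDatumOfRecord F N k U₀) levB a hpos
      (QprOfRecord_surjective_hierFrameGL_of_inUkClassB11 hkm (eps_pos_of_inUkClassB11 hcl) h3 h2 hst hstδ hcl)) y'' y ≤ B₀ * Real.exp (-(ρ * (Site.tdist y''.src y.src : ℝ))))
    (h1 : ∀ y'' y : PBond (F.P K) k, entry1 F N K k Ω U₀ levB (H1prOfRecordAtBg F N K k Ω U₀ (hierFrameGLDatumOfRecord F N k U₀) levB a hpos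
      (QprOfRecord_surjective_hierFrameGL_of_inUkClassB11 hkm (eps_pos_of_inUkClassB11 hcl) h3 h2 hst hstδ hcl)) y'' y ≤ B₀ * Real.exp (-(ρ * (Site.tdist y''.src y.src : ℝ))))
    -- (KL-C)ᵖʳ := the (157) clause of `B7.Prop5Printed (kexpOfRecordPr F N 𝔥ᴳᴸ)` at `(α, α₁, C₃)`, `r + r ≤ α₁`, and the window
    {C₃ α₁ : ℝ} (hC₃ : 0 ≤ C₃)
    (h157 : ∀ (i : KRecIdx F) (W₀ : (kexpOfRecordPr F N (fun K k (U : GaugeField (F.P K) 0 (SU N)) => hierFrameGLDatumOfRecord F N k U) i).Cfg), (kexpOfRecordPr F N (fun K k (U : GaugeField (F.P K) 0 (SU N)) => hierFrameGLDatumOfRecord F N k U) i).plaqDevEta W₀ < α →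
      ∀ A : (kexpOfRecordPr F N (fun K k (U : GaugeField (F.P K) 0 (SU N)) => hierFrameGLDatumOfRecord F N k U) i).Fld, (kexpOfRecordPr F N (fun K k (U : GaugeField (F.P K) 0 (SU N)) => hierFrameGLDatumOfRecord F N k U) i).fldNorm A < α₁ → (kexpOfRecordPr F N (fun K k (U : GaugeField (F.P K) 0 (SU N)) => hierFrameGLDatumOfRecord F N k U) i).dCk W₀ A ≤ C₃ * (kexpOfRecordPr F N (fun K k (U : GaugeField (F.P K) 0 (SU N)) => hierFrameGLDatumOfRecord F N k U) i).fldNorm A)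
    (hrα₁ : letI b : ℝ := B₀ * ((F.P K).d * (2 * (1 + 1 / ρ)) ^ (F.P K).d)
      letI C₂ : ℝ := 281600000000000000 * (F.L : ℝ) * N
      letI c₄ : ℝ := 1 / (200000000000 * (F.L : ℝ) * N)
      letI r : ℝ := min (c₄ / 4) (min (1 / 2) (1 / (16 * (b * C₂ + 1))))
      r + r ≤ α₁)
    -- the window, k-FREE: `(r+r)·Θ_H·G = (r+r)·b·2dC₃ · ((L^d)^k η_k^d) = (r+r)·b·2dC₃` since `L^k η_k = 1`
    (hq : letI b : ℝ := B₀ * ((F.P K).d * (2 * (1 + 1 / ρ)) ^ (F.P K).d)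
      letI C₂ : ℝ := 281600000000000000 * (F.L : ℝ) * N
      letI c₄ : ℝ := 1 / (200000000000 * (F.L : ℝ) * N)
      letI r : ℝ := min (c₄ / 4) (min (1 / 2) (1 / (16 * (b * C₂ + 1))))
      (r + r) * b * (2 * ((F.P K).d : ℝ) * C₃) ≤ 1 / 2)
    -- {W3} := the locality rows of the current reader `Δπ(U₀; G′, Q′)` ([B11] (72)–(73)∕(86)–(89)): (L) fine majorants `s₀, s₁`, (R) block-aggregated row decay — DISPLAYED
    {s0 : Bond (F.P K).d (fun _ => (F.P K).sitesPerDir 0) → Bond (F.P K).d (fun _ => (F.P K).sitesPerDir 0) → ℝ} {s1 : Bond (F.P K).d (fun _ => (F.P K).sitesPerDir 0) → Bond (F.P K).d (fun _ => (F.P K).sitesPerDir 0) × Fin (F.P K).d → ℝ} (hs0 : ∀ b' x, 0 ≤ s0 b' x) (hs1 : ∀ b' p, 0 ≤ s1 b' p)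
    (hS : ∀ (A : Space115Lit F N K k Ω U₀) (b' : Bond (F.P K).d (fun _ => (F.P K).sitesPerDir 0)),
      ‖NegSup.equiv (levWeight (F.L : ℝ) ((F.P K).eta k) (bondLevLit F Ω k) 3) (Matrix (Fin N) (Fin N) ℂ) (DeltaPiCurOfRecord F N K k Ω U₀ Gp (QprimeOfRecord F N k U₀) A) b'‖ ≤
        ∑ x : Bond (F.P K).d (fun _ => (F.P K).sitesPerDir 0), s0 b' x * ‖JetSup.equiv _ _ _ A x‖ +
        ∑ p : Bond (F.P K).d (fun _ => (F.P K).sitesPerDir 0) × Fin (F.P K).d, s1 b' p * ‖(nabla115 ((F.P K).eta k) (unitsOfRecord F N U₀)) (JetSup.equiv _ _ _ A) p‖)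
    {Cπ σ : ℝ} (hCπ : 0 ≤ Cπ) (hσ : 0 < σ)
    (hR : ∀ (b' : Bond (F.P K).d (fun _ => (F.P K).sitesPerDir 0)) (y'' : PBond (F.P K) k),
      blockRow0 F K k s0 b' y'' + blockRow1 F K k s1 b' y'' ≤
        Cπ * Real.exp (-(σ * (Site.tdist (blkOfBond F K k b').src y''.src : ℝ)))) :
    letI b : ℝ := B₀ * ((F.P K).d * (2 * (1 + 1 / ρ)) ^ (F.P K).d)
    letI ΘHw : ℝ := ((((F.P K).L ^ (F.P K).d) ^ k : ℕ) : ℝ) * b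
    letI N₁ : ℝ := Cπ * B₀ * ((F.P K).d * (2 * (1 + 1 / (min σ ρ / 2))) ^ (F.P K).d) * ((F.P K).d * (2 * (1 + 1 / (min σ ρ / 2))) ^ (F.P K).d)
    letI Θ' : ℝ := ((((F.P K).L ^ (F.P K).d) ^ k : ℕ) : ℝ) * N₁
    letI C₂ : ℝ := 281600000000000000 * (F.L : ℝ) * N
    letI c₄ : ℝ := 1 / (200000000000 * (F.L : ℝ) * N)
    letI r : ℝ := min (c₄ / 4) (min (1 / 2) (1 / (16 * (b * C₂ + 1))))
    letI R' : ℝ := min r ((1 - 4 * b * C₂ * (r + r)) * (1 / 16))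
    letI CV : ℝ := 1024 * (((F.P K).d - 1 : ℕ) : ℝ) * ((1 : ℝ) * 1) ^ 3 * N * (α * (1 : ℝ) ^ 2 + 1 / 16)
        + (((F.P K).d - 1 : ℕ) : ℝ) * ((1 : ℝ) * 1) ^ 3 * (136 + 2 * ((1 : ℝ) * 1)) * N
    letI G : ℝ := 2 * ((F.P K).d : ℝ) * (C₃ * (F.P K).eta k ^ (F.P K).d)
    letI θ₃ : ℝ := (2 * (1 / (1 - 4 * b * C₂ * (r + r))) + 1) * ΘHw * G / r
    letI θE : ℝ := 2 * ΘHw * G * (1 / (1 - 4 * b * C₂ * (r + r)))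
    letI θE' : ℝ := 2 * Θ' * G * (1 / (1 - 4 * b * C₂ * (r + r)))
    Prop4UniformPrAtRecord F N K k Ω U₀ (hierFrameGLDatumOfRecord F N k U₀) levB a hpos
      (QprOfRecord_surjective_hierFrameGL_of_inUkClassB11 hkm (eps_pos_of_inUkClassB11 hcl) h3 h2 hst hstδ hcl) r Gp
      ((N * θ₃ * ε₀ + (N₁ * C₂ * (1 / (1 - 4 * b * C₂ * (r + r))) ^ 2 + N * θE')
        + N * θE * (N₁ * C₂ * (1 / (1 - 4 * b * C₂ * (r + r))) ^ 2) * R'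
        + N * (1 + θE * R') * CV * (1 / (1 - 4 * b * C₂ * (r + r))) ^ 2)) R' :=
  prop4UniformPrAtRecord_node00_of_prop5Clause_hierFrameGLRec_of_entryRows_inClass F N K k Ω U₀ levB a hpos Gp hkpos hkm hΩ
    (lt_of_lt_of_le (mul_pos two_pos (eps_pos_of_inUkClassB11 hcl)) hεα) hα (plaqSmall_iter_of_inUkClassB11_of_le h3 h2 hcl hεα)
    h3 h2 hst hstδ hcl hB₀ hρ h0 h1 hC₃ h157 hrα₁ hq hs0 hs1 hS hCπ hσ hR

end InClassReg

/-! ## §2  … at the minimiser of record `UkSel F N K k ε V` -/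

section AtSelectorReg

variable (K k : ℕ) (Ω : ℕ → Set (Site (F.P K) 0))
variable [Fact (0 < (F.L : ℝ))] [Fact (0 < (F.P K).eta k)] [Fact (0 < c0Rec F K k)] [Fact (∀ c, 0 < wBRec F K k c)]

/-- ★★★ **THE (14)-DERIVED IN-CLASS GL PIN AT THE MINIMISER OF RECORD** `U₀ := UkSel F N K k ε V`: §1 with the class letter supplied from [B11] Thm 1's rows AT `V`
(`hex : UkExists … ε V`, `huniq : UniqueUkOrbit … ε V`, `hcl : InUkClassB11 … ε₀ (Uk … ε V)`, 13a §0 ✓`inUkClassB11_ukSel_of_uk`); (14) for `Ū^j(UkSel … V)` DERIVED; everything else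
displayed verbatim at this `U₀`.  Glue BY NAME; Thm 1's rows, {W1}–{W4} INHABITED NOWHERE here.
[cite: Balaban1985Variational, Thm 1 p.279, (2) p.278, (14) p.280, Prop. 4 (97)–(98) pp.292–293; Balaban1985Averaging, Prop. 2 (52)–(53) p.26, Proposition 5 (157) p.42; Balaban1987RG1, (0.21) p.256; Balaban1985BackgroundPropagators, Thm 3.12 (3.133) p.422] -/
theorem prop4UniformPrAtRecord_node00_of_prop5Clause_hierFrameGLRec_of_entryRows_inClassReg_ukSel {ε : ℝ} (V : GaugeField (F.P K) k (SU N)) (levB : PBond (F.P K) k → ℕ) (a : ℝ)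
    (hpos : ∀ x, x ≠ 0 → 0 < RCLike.re ⟪x, laplaceAOfRecord F N k (UkSel F N K k ε V) (QprOfRecord F N k (UkSel F N K k ε V) (hierFrameGLDatumOfRecord F N k (UkSel F N K k ε V))) (QprimeOfRecord F N k (UkSel F N K k ε V)) a x⟫_ℂ)
    (Gp : SiteL2K ℂ (F.P K).d (fun _ => (F.P K).sitesPerDir 0) (c0Rec F K k) (WRec N) →ₗ[ℂ]
      SiteL2K ℂ (F.P K).d (fun _ => (F.P K).sitesPerDir 0) (c0Rec F K k) (WRec N))
    {α ε₀ : ℝ} (hkpos : 0 < k) (hkm : k ≤ (F.P K).m + (F.P K).K) (hΩ : ∀ x, x ∈ Ω k) (hα : α * (11000000 * N) ≤ 1) (hεα : 2 * ε₀ ≤ α)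
    -- {W1}'s un-framed onto row `hqon` AND the current letter `‖J(U₀)‖ ≤ nJ` BOTH from [B11] (2)'s class letter `hcl` (dag-n07-e ✓p835435 `qCplxOp_surjective_of_inUkClassB11`;
    -- ✓`norm_JOfRecordAtBg_le_of_inUkClassB11`, `nJ := ε₀`), at the price of MODULE 144's four ceilings on `ε₀` (`0 < ε₀` is forced by the class: ✓`eps_pos_of_inUkClassB11`)
    (h3 : (143 * (((((F.P K).d + 4 : ℕ) : ℝ)) ^ 2 / 4) ^ 2) * ε₀ ≤ 1 / 3)
    (h2 : 2 * ε₀ ≤ 2 * deltaSU (Fin N) / ((((F.P K).d + 4) * (F.P K).L : ℕ) : ℝ) ^ 2)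
    (hst : stokesConst (F.P K) * (2 * ε₀) < emlWeight (F.P K) / 16) (hstδ : stokesConst (F.P K) * (2 * ε₀) < deltaSU (Fin N))
    -- [B11] Thm 1's rows AT THE DATUM `V` (DISPLAYED; the consumers' currency): solvable at radius `ε`, minimal orbit unique, the minimiser `U_k(V)` in (2)'s class at `ε₀`
    (hex : UkExists F N K k ε V) (huniq : UniqueUkOrbit F N K k ε V) (hcl : InUkClassB11 F N K k ε₀ (Uk F N K k ε V))
    -- {W2} := the (3.133) entry rows of `H₁^{pr}(U₀)` at `(B₀, ρ)` ([B9] Thm 3.12; lane N07) — DISPLAYED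
    {B₀ ρ : ℝ} (hB₀ : 0 ≤ B₀) (hρ : 0 < ρ)
    (h0 : ∀ y'' y : PBond (F.P K) k, entry0 F N K k Ω (UkSel F N K k ε V) levB (H1prOfRecordAtBg F N K k Ω (UkSel F N K k ε V) (hierFrameGLDatumOfRecord F N k (UkSel F N K k ε V)) levB a hpos
      (QprOfRecord_surjective_hierFrameGL_of_inUkClassB11 hkm (eps_pos_of_inUkClassB11 hcl) h3 h2 hst hstδ (inUkClassB11_ukSel_of_uk hkm hex huniq hcl))) y'' y ≤ B₀ * Real.exp (-(ρ * (Site.tdist y''.src y.src : ℝ))))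
    (h1 : ∀ y'' y : PBond (F.P K) k, entry1 F N K k Ω (UkSel F N K k ε V) levB (H1prOfRecordAtBg F N K k Ω (UkSel F N K k ε V) (hierFrameGLDatumOfRecord F N k (UkSel F N K k ε V)) levB a hpos
      (QprOfRecord_surjective_hierFrameGL_of_inUkClassB11 hkm (eps_pos_of_inUkClassB11 hcl) h3 h2 hst hstδ (inUkClassB11_ukSel_of_uk hkm hex huniq hcl))) y'' y ≤ B₀ * Real.exp (-(ρ * (Site.tdist y''.src y.src : ℝ))))
    -- (KL-C)ᵖʳ := the (157) clause of `B7.Prop5Printed (kexpOfRecordPr F N 𝔥ᴳᴸ)` at `(α, α₁, C₃)`, `r + r ≤ α₁`, and the window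
    {C₃ α₁ : ℝ} (hC₃ : 0 ≤ C₃)
    (h157 : ∀ (i : KRecIdx F) (W₀ : (kexpOfRecordPr F N (fun K k (U : GaugeField (F.P K) 0 (SU N)) => hierFrameGLDatumOfRecord F N k U) i).Cfg), (kexpOfRecordPr F N (fun K k (U : GaugeField (F.P K) 0 (SU N)) => hierFrameGLDatumOfRecord F N k U) i).plaqDevEta W₀ < α →
      ∀ A : (kexpOfRecordPr F N (fun K k (U : GaugeField (F.P K) 0 (SU N)) => hierFrameGLDatumOfRecord F N k U) i).Fld, (kexpOfRecordPr F N (fun K k (U : GaugeField (F.P K) 0 (SU N)) => hierFrameGLDatumOfRecord F N k U) i).fldNorm A < α₁ → (kexpOfRecordPr F N (fun K k (U : GaugeField (F.P K) 0 (SU N)) => hierFrameGLDatumOfRecord F N k U) i).dCk W₀ A ≤ C₃ * (kexpOfRecordPr F N (fun K k (U : GaugeField (F.P K) 0 (SU N)) => hierFrameGLDatumOfRecord F N k U) i).fldNorm A)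
    (hrα₁ : letI b : ℝ := B₀ * ((F.P K).d * (2 * (1 + 1 / ρ)) ^ (F.P K).d)
      letI C₂ : ℝ := 281600000000000000 * (F.L : ℝ) * N
      letI c₄ : ℝ := 1 / (200000000000 * (F.L : ℝ) * N)
      letI r : ℝ := min (c₄ / 4) (min (1 / 2) (1 / (16 * (b * C₂ + 1))))
      r + r ≤ α₁)
    -- the window, k-FREE: `(r+r)·Θ_H·G = (r+r)·b·2dC₃ · ((L^d)^k η_k^d) = (r+r)·b·2dC₃` since `L^k η_k = 1`
    (hq : letI b : ℝ := B₀ * ((F.P K).d * (2 * (1 + 1 / ρ)) ^ (F.P K).d)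
      letI C₂ : ℝ := 281600000000000000 * (F.L : ℝ) * N
      letI c₄ : ℝ := 1 / (200000000000 * (F.L : ℝ) * N)
      letI r : ℝ := min (c₄ / 4) (min (1 / 2) (1 / (16 * (b * C₂ + 1))))
      (r + r) * b * (2 * ((F.P K).d : ℝ) * C₃) ≤ 1 / 2)
    -- {W3} := the locality rows of the current reader `Δπ(U₀; G′, Q′)` ([B11] (72)–(73)∕(86)–(89)): (L) fine majorants `s₀, s₁`, (R) block-aggregated row decay — DISPLAYED
    {s0 : Bond (F.P K).d (fun _ => (F.P K).sitesPerDir 0) → Bond (F.P K).d (fun _ => (F.P K).sitesPerDir 0) → ℝ} {s1 : Bond (F.P K).d (fun _ => (F.P K).sitesPerDir 0) → Bond (F.P K).d (fun _ => (F.P K).sitesPerDir 0) × Fin (F.P K).d → ℝ} (hs0 : ∀ b' x, 0 ≤ s0 b' x) (hs1 : ∀ b' p, 0 ≤ s1 b' p)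
    (hS : ∀ (A : Space115Lit F N K k Ω (UkSel F N K k ε V)) (b' : Bond (F.P K).d (fun _ => (F.P K).sitesPerDir 0)),
      ‖NegSup.equiv (levWeight (F.L : ℝ) ((F.P K).eta k) (bondLevLit F Ω k) 3) (Matrix (Fin N) (Fin N) ℂ) (DeltaPiCurOfRecord F N K k Ω (UkSel F N K k ε V) Gp (QprimeOfRecord F N k (UkSel F N K k ε V)) A) b'‖ ≤
        ∑ x : Bond (F.P K).d (fun _ => (F.P K).sitesPerDir 0), s0 b' x * ‖JetSup.equiv _ _ _ A x‖ +
        ∑ p : Bond (F.P K).d (fun _ => (F.P K).sitesPerDir 0) × Fin (F.P K).d, s1 b' p * ‖(nabla115 ((F.P K).eta k) (unitsOfRecord F N (UkSel F N K k ε V))) (JetSup.equiv _ _ _ A) p‖)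
    {Cπ σ : ℝ} (hCπ : 0 ≤ Cπ) (hσ : 0 < σ)
    (hR : ∀ (b' : Bond (F.P K).d (fun _ => (F.P K).sitesPerDir 0)) (y'' : PBond (F.P K) k),
      blockRow0 F K k s0 b' y'' + blockRow1 F K k s1 b' y'' ≤
        Cπ * Real.exp (-(σ * (Site.tdist (blkOfBond F K k b').src y''.src : ℝ)))) :
    letI b : ℝ := B₀ * ((F.P K).d * (2 * (1 + 1 / ρ)) ^ (F.P K).d)
    letI ΘHw : ℝ := ((((F.P K).L ^ (F.P K).d) ^ k : ℕ) : ℝ) * b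
    letI N₁ : ℝ := Cπ * B₀ * ((F.P K).d * (2 * (1 + 1 / (min σ ρ / 2))) ^ (F.P K).d) * ((F.P K).d * (2 * (1 + 1 / (min σ ρ / 2))) ^ (F.P K).d)
    letI Θ' : ℝ := ((((F.P K).L ^ (F.P K).d) ^ k : ℕ) : ℝ) * N₁
    letI C₂ : ℝ := 281600000000000000 * (F.L : ℝ) * N
    letI c₄ : ℝ := 1 / (200000000000 * (F.L : ℝ) * N)
    letI r : ℝ := min (c₄ / 4) (min (1 / 2) (1 / (16 * (b * C₂ + 1))))
    letI R' : ℝ := min r ((1 - 4 * b * C₂ * (r + r)) * (1 / 16))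
    letI CV : ℝ := 1024 * (((F.P K).d - 1 : ℕ) : ℝ) * ((1 : ℝ) * 1) ^ 3 * N * (α * (1 : ℝ) ^ 2 + 1 / 16)
        + (((F.P K).d - 1 : ℕ) : ℝ) * ((1 : ℝ) * 1) ^ 3 * (136 + 2 * ((1 : ℝ) * 1)) * N
    letI G : ℝ := 2 * ((F.P K).d : ℝ) * (C₃ * (F.P K).eta k ^ (F.P K).d)
    letI θ₃ : ℝ := (2 * (1 / (1 - 4 * b * C₂ * (r + r))) + 1) * ΘHw * G / r
    letI θE : ℝ := 2 * ΘHw * G * (1 / (1 - 4 * b * C₂ * (r + r)))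
    letI θE' : ℝ := 2 * Θ' * G * (1 / (1 - 4 * b * C₂ * (r + r)))
    Prop4UniformPrAtRecord F N K k Ω (UkSel F N K k ε V) (hierFrameGLDatumOfRecord F N k (UkSel F N K k ε V)) levB a hpos
      (QprOfRecord_surjective_hierFrameGL_of_inUkClassB11 hkm (eps_pos_of_inUkClassB11 hcl) h3 h2 hst hstδ (inUkClassB11_ukSel_of_uk hkm hex huniq hcl)) r Gp
      ((N * θ₃ * ε₀ + (N₁ * C₂ * (1 / (1 - 4 * b * C₂ * (r + r))) ^ 2 + N * θE')
        + N * θE * (N₁ * C₂ * (1 / (1 - 4 * b * C₂ * (r + r))) ^ 2) * R'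
        + N * (1 + θE * R') * CV * (1 / (1 - 4 * b * C₂ * (r + r))) ^ 2)) R' :=
  prop4UniformPrAtRecord_node00_of_prop5Clause_hierFrameGLRec_of_entryRows_inClassReg F N K k Ω (UkSel F N K k ε V) levB a hpos Gp hkpos hkm hΩ hα hεα h3 h2 hst hstδ
    (inUkClassB11_ukSel_of_uk hkm hex huniq hcl) hB₀ hρ h0 h1 hC₃ h157 hrα₁ hq hs0 hs1 hS hCπ hσ hR

/-! ## §3  … and at its centred rooted gauge `rootGaugeC k (UkSel F N K k ε V)` -/

/-- ★★★ **THE (14)-DERIVED IN-CLASS GL PIN AT THE CENTRED ROOTED GAUGE OF THE MINIMISER OF RECORD** `U₀ := rootGaugeC k (UkSel F N K k ε V)` (DEF-1's `recordBgFieldC` shape):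
§1 with the class letter from 13a §0 ✓`inUkClassB11_rootGaugeC_ukSel_of_uk`; (14) DERIVED; everything else displayed verbatim at this `U₀`.  Glue BY NAME; Thm 1's rows, {W1}–{W4}
INHABITED NOWHERE here.
[cite: Balaban1985Variational, Thm 1 p.279, (2) p.278, (14) p.280, (19) p.281, Prop. 4 (97)–(98) pp.292–293; Balaban1985Averaging, Prop. 2 (52)–(53) p.26, Proposition 5 (157) p.42; Balaban1987RG1, (0.21) p.256, (2.3) p.265; Balaban1985BackgroundPropagators, Thm 3.12 (3.133) p.422] -/
theorem prop4UniformPrAtRecord_node00_of_prop5Clause_hierFrameGLRec_of_entryRows_inClassReg_rootGaugeC_ukSel {ε : ℝ} (V : GaugeField (F.P K) k (SU N)) (levB : PBond (F.P K) k → ℕ) (a : ℝ)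
    (hpos : ∀ x, x ≠ 0 → 0 < RCLike.re ⟪x, laplaceAOfRecord F N k (rootGaugeC k (UkSel F N K k ε V)) (QprOfRecord F N k (rootGaugeC k (UkSel F N K k ε V)) (hierFrameGLDatumOfRecord F N k (rootGaugeC k (UkSel F N K k ε V)))) (QprimeOfRecord F N k (rootGaugeC k (UkSel F N K k ε V))) a x⟫_ℂ)
    (Gp : SiteL2K ℂ (F.P K).d (fun _ => (F.P K).sitesPerDir 0) (c0Rec F K k) (WRec N) →ₗ[ℂ]
      SiteL2K ℂ (F.P K).d (fun _ => (F.P K).sitesPerDir 0) (c0Rec F K k) (WRec N))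
    {α ε₀ : ℝ} (hkpos : 0 < k) (hkm : k ≤ (F.P K).m + (F.P K).K) (hΩ : ∀ x, x ∈ Ω k) (hα : α * (11000000 * N) ≤ 1) (hεα : 2 * ε₀ ≤ α)
    -- {W1}'s un-framed onto row `hqon` AND the current letter `‖J(U₀)‖ ≤ nJ` BOTH from [B11] (2)'s class letter `hcl` (dag-n07-e ✓p835435 `qCplxOp_surjective_of_inUkClassB11`;
    -- ✓`norm_JOfRecordAtBg_le_of_inUkClassB11`, `nJ := ε₀`), at the price of MODULE 144's four ceilings on `ε₀` (`0 < ε₀` is forced by the class: ✓`eps_pos_of_inUkClassB11`)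
    (h3 : (143 * (((((F.P K).d + 4 : ℕ) : ℝ)) ^ 2 / 4) ^ 2) * ε₀ ≤ 1 / 3)
    (h2 : 2 * ε₀ ≤ 2 * deltaSU (Fin N) / ((((F.P K).d + 4) * (F.P K).L : ℕ) : ℝ) ^ 2)
    (hst : stokesConst (F.P K) * (2 * ε₀) < emlWeight (F.P K) / 16) (hstδ : stokesConst (F.P K) * (2 * ε₀) < deltaSU (Fin N))
    -- [B11] Thm 1's rows AT THE DATUM `V` (DISPLAYED; the consumers' currency): solvable at radius `ε`, minimal orbit unique, the minimiser `U_k(V)` in (2)'s class at `ε₀`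
    (hex : UkExists F N K k ε V) (huniq : UniqueUkOrbit F N K k ε V) (hcl : InUkClassB11 F N K k ε₀ (Uk F N K k ε V))
    -- {W2} := the (3.133) entry rows of `H₁^{pr}(U₀)` at `(B₀, ρ)` ([B9] Thm 3.12; lane N07) — DISPLAYED
    {B₀ ρ : ℝ} (hB₀ : 0 ≤ B₀) (hρ : 0 < ρ)
    (h0 : ∀ y'' y : PBond (F.P K) k, entry0 F N K k Ω (rootGaugeC k (UkSel F N K k ε V)) levB (H1prOfRecordAtBg F N K k Ω (rootGaugeC k (UkSel F N K k ε V)) (hierFrameGLDatumOfRecord F N k (rootGaugeC k (UkSel F N K k ε V))) levB a hpos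
      (QprOfRecord_surjective_hierFrameGL_of_inUkClassB11 hkm (eps_pos_of_inUkClassB11 hcl) h3 h2 hst hstδ (inUkClassB11_rootGaugeC_ukSel_of_uk hkm hex huniq hcl))) y'' y ≤ B₀ * Real.exp (-(ρ * (Site.tdist y''.src y.src : ℝ))))
    (h1 : ∀ y'' y : PBond (F.P K) k, entry1 F N K k Ω (rootGaugeC k (UkSel F N K k ε V)) levB (H1prOfRecordAtBg F N K k Ω (rootGaugeC k (UkSel F N K k ε V)) (hierFrameGLDatumOfRecord F N k (rootGaugeC k (UkSel F N K k ε V))) levB a hpos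
      (QprOfRecord_surjective_hierFrameGL_of_inUkClassB11 hkm (eps_pos_of_inUkClassB11 hcl) h3 h2 hst hstδ (inUkClassB11_rootGaugeC_ukSel_of_uk hkm hex huniq hcl))) y'' y ≤ B₀ * Real.exp (-(ρ * (Site.tdist y''.src y.src : ℝ))))
    -- (KL-C)ᵖʳ := the (157) clause of `B7.Prop5Printed (kexpOfRecordPr F N 𝔥ᴳᴸ)` at `(α, α₁, C₃)`, `r + r ≤ α₁`, and the window
    {C₃ α₁ : ℝ} (hC₃ : 0 ≤ C₃)
    (h157 : ∀ (i : KRecIdx F) (W₀ : (kexpOfRecordPr F N (fun K k (U : GaugeField (F.P K) 0 (SU N)) => hierFrameGLDatumOfRecord F N k U) i).Cfg), (kexpOfRecordPr F N (fun K k (U : GaugeField (F.P K) 0 (SU N)) => hierFrameGLDatumOfRecord F N k U) i).plaqDevEta W₀ < α →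
      ∀ A : (kexpOfRecordPr F N (fun K k (U : GaugeField (F.P K) 0 (SU N)) => hierFrameGLDatumOfRecord F N k U) i).Fld, (kexpOfRecordPr F N (fun K k (U : GaugeField (F.P K) 0 (SU N)) => hierFrameGLDatumOfRecord F N k U) i).fldNorm A < α₁ → (kexpOfRecordPr F N (fun K k (U : GaugeField (F.P K) 0 (SU N)) => hierFrameGLDatumOfRecord F N k U) i).dCk W₀ A ≤ C₃ * (kexpOfRecordPr F N (fun K k (U : GaugeField (F.P K) 0 (SU N)) => hierFrameGLDatumOfRecord F N k U) i).fldNorm A)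
    (hrα₁ : letI b : ℝ := B₀ * ((F.P K).d * (2 * (1 + 1 / ρ)) ^ (F.P K).d)
      letI C₂ : ℝ := 281600000000000000 * (F.L : ℝ) * N
      letI c₄ : ℝ := 1 / (200000000000 * (F.L : ℝ) * N)
      letI r : ℝ := min (c₄ / 4) (min (1 / 2) (1 / (16 * (b * C₂ + 1))))
      r + r ≤ α₁)
    -- the window, k-FREE: `(r+r)·Θ_H·G = (r+r)·b·2dC₃ · ((L^d)^k η_k^d) = (r+r)·b·2dC₃` since `L^k η_k = 1`
    (hq : letI b : ℝ := B₀ * ((F.P K).d * (2 * (1 + 1 / ρ)) ^ (F.P K).d)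
      letI C₂ : ℝ := 281600000000000000 * (F.L : ℝ) * N
      letI c₄ : ℝ := 1 / (200000000000 * (F.L : ℝ) * N)
      letI r : ℝ := min (c₄ / 4) (min (1 / 2) (1 / (16 * (b * C₂ + 1))))
      (r + r) * b * (2 * ((F.P K).d : ℝ) * C₃) ≤ 1 / 2)
    -- {W3} := the locality rows of the current reader `Δπ(U₀; G′, Q′)` ([B11] (72)–(73)∕(86)–(89)): (L) fine majorants `s₀, s₁`, (R) block-aggregated row decay — DISPLAYED
    {s0 : Bond (F.P K).d (fun _ => (F.P K).sitesPerDir 0) → Bond (F.P K).d (fun _ => (F.P K).sitesPerDir 0) → ℝ} {s1 : Bond (F.P K).d (fun _ => (F.P K).sitesPerDir 0) → Bond (F.P K).d (fun _ => (F.P K).sitesPerDir 0) × Fin (F.P K).d → ℝ} (hs0 : ∀ b' x, 0 ≤ s0 b' x) (hs1 : ∀ b' p, 0 ≤ s1 b' p)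
    (hS : ∀ (A : Space115Lit F N K k Ω (rootGaugeC k (UkSel F N K k ε V))) (b' : Bond (F.P K).d (fun _ => (F.P K).sitesPerDir 0)),
      ‖NegSup.equiv (levWeight (F.L : ℝ) ((F.P K).eta k) (bondLevLit F Ω k) 3) (Matrix (Fin N) (Fin N) ℂ) (DeltaPiCurOfRecord F N K k Ω (rootGaugeC k (UkSel F N K k ε V)) Gp (QprimeOfRecord F N k (rootGaugeC k (UkSel F N K k ε V))) A) b'‖ ≤
        ∑ x : Bond (F.P K).d (fun _ => (F.P K).sitesPerDir 0), s0 b' x * ‖JetSup.equiv _ _ _ A x‖ +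
        ∑ p : Bond (F.P K).d (fun _ => (F.P K).sitesPerDir 0) × Fin (F.P K).d, s1 b' p * ‖(nabla115 ((F.P K).eta k) (unitsOfRecord F N (rootGaugeC k (UkSel F N K k ε V)))) (JetSup.equiv _ _ _ A) p‖)
    {Cπ σ : ℝ} (hCπ : 0 ≤ Cπ) (hσ : 0 < σ)
    (hR : ∀ (b' : Bond (F.P K).d (fun _ => (F.P K).sitesPerDir 0)) (y'' : PBond (F.P K) k),
      blockRow0 F K k s0 b' y'' + blockRow1 F K k s1 b' y'' ≤
        Cπ * Real.exp (-(σ * (Site.tdist (blkOfBond F K k b').src y''.src : ℝ)))) :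
    letI b : ℝ := B₀ * ((F.P K).d * (2 * (1 + 1 / ρ)) ^ (F.P K).d)
    letI ΘHw : ℝ := ((((F.P K).L ^ (F.P K).d) ^ k : ℕ) : ℝ) * b
    letI N₁ : ℝ := Cπ * B₀ * ((F.P K).d * (2 * (1 + 1 / (min σ ρ / 2))) ^ (F.P K).d) * ((F.P K).d * (2 * (1 + 1 / (min σ ρ / 2))) ^ (F.P K).d)
    letI Θ' : ℝ := ((((F.P K).L ^ (F.P K).d) ^ k : ℕ) : ℝ) * N₁
    letI C₂ : ℝ := 281600000000000000 * (F.L : ℝ) * N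
    letI c₄ : ℝ := 1 / (200000000000 * (F.L : ℝ) * N)
    letI r : ℝ := min (c₄ / 4) (min (1 / 2) (1 / (16 * (b * C₂ + 1))))
    letI R' : ℝ := min r ((1 - 4 * b * C₂ * (r + r)) * (1 / 16))
    letI CV : ℝ := 1024 * (((F.P K).d - 1 : ℕ) : ℝ) * ((1 : ℝ) * 1) ^ 3 * N * (α * (1 : ℝ) ^ 2 + 1 / 16)
        + (((F.P K).d - 1 : ℕ) : ℝ) * ((1 : ℝ) * 1) ^ 3 * (136 + 2 * ((1 : ℝ) * 1)) * N
    letI G : ℝ := 2 * ((F.P K).d : ℝ) * (C₃ * (F.P K).eta k ^ (F.P K).d)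
    letI θ₃ : ℝ := (2 * (1 / (1 - 4 * b * C₂ * (r + r))) + 1) * ΘHw * G / r
    letI θE : ℝ := 2 * ΘHw * G * (1 / (1 - 4 * b * C₂ * (r + r)))
    letI θE' : ℝ := 2 * Θ' * G * (1 / (1 - 4 * b * C₂ * (r + r)))
    Prop4UniformPrAtRecord F N K k Ω (rootGaugeC k (UkSel F N K k ε V)) (hierFrameGLDatumOfRecord F N k (rootGaugeC k (UkSel F N K k ε V))) levB a hpos
      (QprOfRecord_surjective_hierFrameGL_of_inUkClassB11 hkm (eps_pos_of_inUkClassB11 hcl) h3 h2 hst hstδ (inUkClassB11_rootGaugeC_ukSel_of_uk hkm hex huniq hcl)) r Gp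
      ((N * θ₃ * ε₀ + (N₁ * C₂ * (1 / (1 - 4 * b * C₂ * (r + r))) ^ 2 + N * θE')
        + N * θE * (N₁ * C₂ * (1 / (1 - 4 * b * C₂ * (r + r))) ^ 2) * R'
        + N * (1 + θE * R') * CV * (1 / (1 - 4 * b * C₂ * (r + r))) ^ 2)) R' :=
  prop4UniformPrAtRecord_node00_of_prop5Clause_hierFrameGLRec_of_entryRows_inClassReg F N K k Ω (rootGaugeC k (UkSel F N K k ε V)) levB a hpos Gp hkpos hkm hΩ hα hεα
    h3 h2 hst hstδ (inUkClassB11_rootGaugeC_ukSel_of_uk hkm hex huniq hcl) hB₀ hρ h0 h1 hC₃ h157 hrα₁ hq hs0 hs1 hS hCπ hσ hR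

end AtSelectorReg

end Summit.QuantumFields.YangMills.Theorems.KExpOfRecordPr

end
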